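import Mathlib
import HarnessLib
import Summits.HubbardSuperconductivity.HubbardSuperconductivity.Theorems.KLProgrammeC4aPPKernelMidRows

/-!
# Route `KLProgramme` — crux C4a, S3 brick (B4) «(B4)-UMK1», «(U1)-M-LAW» kernel side: the OPPOSITE-SIGN THERMAL ROW `hKopp` of the smooth comparable-levels
# piece — `lo ≤ e`, `u ≤ −e/4` ⟹ `|∂ᵤM(e,u)| ≤ C_t·lo·(max e |u|)⁻³`, `C_t = 8q′C₁·(Λ/lo) + ((1+2κ₀)48q′³ + 16κ₁q′²)/(β·lo)`

Cell `gate-hubbard-kl`, seat hubbard-kl-k3c3-p1 (g17; row «δμ-flow with klAngularMean constant piece»).  Part 3 of the M-rows for k3c3-p3's «(U1)-M-LAW» (5b-M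
`…C4aPreCausticLevelLineMiddle`, binder `hKopp : ∀ e ∈ [lo,hi], ∀ u ≤ −e/4, |∂ᵤK(e,u)| ≤ C_t·lo/max(e,|u|)³` — «thermal saturation of the pp numerator on opposite-sign
comparable levels», k3c3-p3 g34 l.11662 (iii)/(T)).  Two regimes on the comparable zone (off it `∂ᵤM = 0`):
* scale `max(e,|u|) ≤ 8q′Λ`: the envelope `hK1` of part 2, `C₁/M² ≤ 8q′C₁(Λ/lo)·lo/M³`;
* scale `max(e,|u|) > 8q′Λ`: comparability puts BOTH lines beyond the shell (`e, |u| > Λ`), where the mixed-sign kernel is the thermal difference quotient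
  `P(e,u) = ½(tanh(βe/2) − tanh(β|u|/2))/(e − |u|)` EXACTLY (`…C4aPPKernelNegPreThermal`, parity `P(−e,−u) = P(e,u)`); two mean values give
  `|∂ᵤP| ≤ β²e^{−βm}`, `|P| ≤ βe^{−βm}` with `m = min(e,|u|) ≥ M/(2q′)`, and `(βM)³e^{−βM/(2q′)} ≤ 48q′³`, `(βM)²e^{−βM/(2q′)} ≤ 8q′²` convert to `lo/M³` at the price `1/(β·lo)`.
* §1 `abs_thermalDiagonal_deriv_le_of_le` / `abs_thermalDiagonal_le_of_le` (the thermal sizes against any `m ≤ min(s,u)` — `…NegPreThermal` §4 had `m = s/2`);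
* §2 `abs_ppTrueKernelDu_opp_far_le` / `abs_ppTrueKernel_opp_far_le` (`Λ < e`, `Λ < −u`, `u ≠ −e`); §3 `pow_three_mul_exp_neg_le`;
* §4 `midNear_conv`, `midFar_scales`, `midFar_conv_sq/_one`; §5 `abs_midDeriv_far_le`, **`abs_deriv_ppMidKernelS_opp_le`** (THE ROW, every `u ≤ −e/4`; `u = −e` by continuity).
`n`-free reading: `lo ≍ Λ` (`Λ/lo`), `β·lo ≥ c` (`1/(β·lo)`) — the KL regime's `βΛₙ ≥ π`.  Pure real analysis; nothing asserts (C), K3, the window or superconductivity.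
References: BGM 2006 §2.1 (2.2)–(2.5), §2.4 (2.36) [cite: BenfattoGiulianiMastropietro2006]; FST II CPAM 51 (1998) §3 [cite: FeldmanSalmhoferTrubowitz1998].
-/

noncomputable section

namespace Summit.HubbardSuperconductivity.HubbardSuperconductivity.Theorems.C4a

set_option linter.dupNamespace false -- summit = problem name (single-conjunct summit), D-0017

open Real Filter Set
open scoped Topology
open Literature.MathematicalPhysics.QuantumLattice Literature.Analysis.SpecialFunctions

/-! ## §1 The thermal sizes against an arbitrary lower level `m ≤ min(s,u)` -/

set_option maxHeartbeats 400000 in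
/-- **Derivative of the thermal difference quotient**: `0 ≤ m ≤ s`, `m ≤ u`, `u ≠ s` ⟹
`|(β/4)sech²(βu/2)/(u − s) − ½(tanh(βu/2) − tanh(βs/2))/(u − s)²| ≤ β²·e^{−βm}` (two mean values; the intermediate point is `≥ min(s,u) ≥ m`).
[cite: BenfattoGiulianiMastropietro2006, §2.1 (2.2)-(2.5)] -/
theorem abs_thermalDiagonal_deriv_le_of_le {β s u m : ℝ} (hβ : 0 < β) (hm : 0 ≤ m) (hms : m ≤ s) (hmu : m ≤ u) (hne : u ≠ s) :
    |β / 4 * sech (β * u / 2) ^ 2 / (u - s) - 1 / 2 * (Real.tanh (β * u / 2) - Real.tanh (β * s / 2)) / (u - s) ^ 2| ≤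
      β ^ 2 * Real.exp (-(β * m)) := by
  set f' : ℝ → ℝ := fun y => β / 2 * sech (β * y / 2) ^ 2 with hf'
  set f'' : ℝ → ℝ := fun y => -(β ^ 2 / 2) * sech (β * y / 2) ^ 2 * Real.tanh (β * y / 2) with hf''
  have hd1 : ∀ y, HasDerivAt (fun y : ℝ => Real.tanh (β * y / 2)) (f' y) y := fun y => hasDerivAt_tanh_scaled β y
  have hd2 : ∀ y, HasDerivAt f' (f'' y) y := fun y => hasDerivAt_sech_sq_scaled β y
  have hus : u - s ≠ 0 := sub_ne_zero.2 hne
  obtain ⟨η, hη1, hη2, hη⟩ := exists_between_hasDerivAt_eq_slope hd1 hne.symm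
  have hexpr : β / 4 * sech (β * u / 2) ^ 2 / (u - s) - 1 / 2 * (Real.tanh (β * u / 2) - Real.tanh (β * s / 2)) / (u - s) ^ 2 =
      1 / 2 * (f' u - f' η) / (u - s) := by
    rw [hη]; simp only [hf']; field_simp; ring
  have hηu : η ≠ u := by
    intro h
    rw [h] at hη1 hη2
    rcases lt_or_gt_of_ne hne with h' | h'
    · rw [min_eq_right h'.le] at hη1; exact lt_irrefl _ hη1
    · rw [max_eq_right h'.le] at hη2; exact lt_irrefl _ hη2
  obtain ⟨ζ, hζ1, _hζ2, hζ⟩ := exists_between_hasDerivAt_eq_slope hd2 hηu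
  rw [hexpr, hζ]
  have hratio : |u - η| ≤ |u - s| := by
    rcases lt_or_gt_of_ne hne with h' | h'
    · rw [min_eq_right h'.le] at hη1
      rw [max_eq_left h'.le] at hη2
      rw [abs_of_neg (by linarith), abs_of_neg (by linarith)]
      linarith
    · rw [min_eq_left h'.le] at hη1
      rw [max_eq_right h'.le] at hη2
      rw [abs_of_pos (by linarith), abs_of_pos (by linarith)]
      linarith
  -- `ζ ≥ m`
  have hζm : m ≤ ζ := by
    have hηm : m ≤ η := by have := min_le_iff.1 (le_of_lt hη1); rcases lt_or_gt_of_ne hne with h' | h' <;> [rw [min_eq_right h'.le] at hη1; rw [min_eq_left h'.le] at hη1] <;> linarith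
    have : min η u ≤ ζ := le_of_lt hζ1
    have hmin : m ≤ min η u := le_min hηm hmu
    linarith
  have hf''le : |f'' ζ| ≤ 2 * β ^ 2 * Real.exp (-(β * m)) := by
    simp only [hf'']
    have hζ0 : 0 ≤ ζ := hm.trans hζm
    have hsech : sech (β * ζ / 2) ^ 2 ≤ 4 * Real.exp (-(2 * |β * ζ / 2|)) := sech_sq_le_four_exp_neg _
    have habs : 2 * |β * ζ / 2| = β * ζ := by rw [abs_of_nonneg (by positivity)]; ring
    rw [habs] at hsech
    have hexp : Real.exp (-(β * ζ)) ≤ Real.exp (-(β * m)) := Real.exp_le_exp.2 (by nlinarith)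
    have htanh : |Real.tanh (β * ζ / 2)| ≤ 1 := by rw [abs_le]; exact ⟨(Real.neg_one_lt_tanh _).le, (Real.tanh_lt_one _).le⟩
    rw [abs_mul, abs_mul, abs_neg, abs_of_pos (by positivity : (0 : ℝ) < β ^ 2 / 2), abs_of_nonneg (by positivity : (0 : ℝ) ≤ sech (β * ζ / 2) ^ 2)]
    have hsech' : sech (β * ζ / 2) ^ 2 ≤ 4 * Real.exp (-(β * m)) := hsech.trans (by linarith)
    calc β ^ 2 / 2 * sech (β * ζ / 2) ^ 2 * |Real.tanh (β * ζ / 2)| ≤ β ^ 2 / 2 * (4 * Real.exp (-(β * m))) * 1 :=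
          mul_le_mul (mul_le_mul_of_nonneg_left hsech' (by positivity)) htanh (abs_nonneg _) (by positivity)
      _ = 2 * β ^ 2 * Real.exp (-(β * m)) := by ring
  have hus' : 0 < |u - s| := abs_pos.2 hus
  rw [abs_div, abs_mul, abs_mul, abs_of_pos (by norm_num : (0 : ℝ) < 1 / 2)]
  calc 1 / 2 * (|f'' ζ| * |u - η|) / |u - s| ≤ 1 / 2 * (|f'' ζ| * |u - s|) / |u - s| := by gcongr
    _ = 1 / 2 * |f'' ζ| := by field_simp
    _ ≤ 1 / 2 * (2 * β ^ 2 * Real.exp (-(β * m))) := by gcongr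
    _ = β ^ 2 * Real.exp (-(β * m)) := by ring

/-- **Value of the thermal difference quotient**: `0 ≤ m ≤ s`, `m ≤ u`, `u ≠ s` ⟹ `|½(tanh(βu/2) − tanh(βs/2))/(u − s)| ≤ β·e^{−βm}` (one mean value).
[cite: BenfattoGiulianiMastropietro2006, §2.1 (2.2)-(2.5)] -/
theorem abs_thermalDiagonal_le_of_le {β s u m : ℝ} (hβ : 0 < β) (hm : 0 ≤ m) (hms : m ≤ s) (hmu : m ≤ u) (hne : u ≠ s) :
    |1 / 2 * (Real.tanh (β * u / 2) - Real.tanh (β * s / 2)) / (u - s)| ≤ β * Real.exp (-(β * m)) := by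
  have hd1 : ∀ y, HasDerivAt (fun y : ℝ => Real.tanh (β * y / 2)) (β / 2 * sech (β * y / 2) ^ 2) y := fun y => hasDerivAt_tanh_scaled β y
  have hus : u - s ≠ 0 := sub_ne_zero.2 hne
  obtain ⟨η, hη1, _hη2, hη⟩ := exists_between_hasDerivAt_eq_slope hd1 hne.symm
  rw [hη, show 1 / 2 * (β / 2 * sech (β * η / 2) ^ 2 * (u - s)) / (u - s) = β / 4 * sech (β * η / 2) ^ 2 by field_simp; ring]
  have hηm : m ≤ η := by
    have hmin : m ≤ min s u := le_min hms hmu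
    linarith
  have hη0 : 0 ≤ η := hm.trans hηm
  have hsech : sech (β * η / 2) ^ 2 ≤ 4 * Real.exp (-(2 * |β * η / 2|)) := sech_sq_le_four_exp_neg _
  have habs : 2 * |β * η / 2| = β * η := by rw [abs_of_nonneg (by positivity)]; ring
  rw [habs] at hsech
  have hexp : Real.exp (-(β * η)) ≤ Real.exp (-(β * m)) := Real.exp_le_exp.2 (by nlinarith)
  rw [abs_of_nonneg (by positivity)]
  calc β / 4 * sech (β * η / 2) ^ 2 ≤ β / 4 * (4 * Real.exp (-(β * m))) := by gcongr; exact hsech.trans (by linarith)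
    _ = β * Real.exp (-(β * m)) := by ring

/-! ## §2 Transport to the true kernel at opposite-sign far levels -/

/-- **`|∂ᵤP(e,u)| ≤ β²e^{−βm}`** for `Λ < e`, `Λ < −u`, `u ≠ −e`, `0 ≤ m ≤ e`, `m ≤ −u` (parity `∂ᵤP(e,u) = −∂ᵤP(−e,−u)` and the far closed form).
[cite: BenfattoGiulianiMastropietro2006, §2.4 (2.36)] -/
theorem abs_ppTrueKernelDu_opp_far_le {β Λ : ℝ} (hβ : 0 < β) (hΛ : 0 < Λ) {B₁ : ℝ} (hB₁ : ∀ x, |deriv salmhoferCutoff x| ≤ B₁) {e u m : ℝ}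
    (he : Λ < e) (hu : Λ < -u) (hne : u ≠ -e) (hm : 0 ≤ m) (hme : m ≤ e) (hmu : m ≤ -u) :
    |ppTrueKernelDu β Λ e u| ≤ β ^ 2 * Real.exp (-(β * m)) := by
  have h1 : ppTrueKernelDu β Λ e u = -ppTrueKernelDu β Λ (-e) (-u) := by rw [ppTrueKernelDu_neg_neg, neg_neg]
  rw [h1, abs_neg, ppTrueKernelDu_negLevel_far_eq hβ hΛ hB₁ he hu (fun h => hne (by linarith))]
  exact abs_thermalDiagonal_deriv_le_of_le hβ hm hme hmu (fun h => hne (by linarith))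

/-- **`|P(e,u)| ≤ βe^{−βm}`** for `Λ < e`, `Λ < −u`, `u ≠ −e`, `0 ≤ m ≤ e`, `m ≤ −u`. [cite: BenfattoGiulianiMastropietro2006, §2.4 (2.36)] -/
theorem abs_ppTrueKernel_opp_far_le {β Λ : ℝ} (hβ : 0 < β) (hΛ : 0 < Λ) {e u m : ℝ}
    (he : Λ < e) (hu : Λ < -u) (hne : u ≠ -e) (hm : 0 ≤ m) (hme : m ≤ e) (hmu : m ≤ -u) :
    |ppTrueKernel β Λ e u| ≤ β * Real.exp (-(β * m)) := by
  have h1 : ppTrueKernel β Λ e u = ppTrueKernel β Λ (-e) (-u) := by rw [ppTrueKernel_neg_neg]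
  have hfar : Λ < |(-u)| := by rw [abs_of_pos (hΛ.trans hu)]; exact hu
  rw [h1, ppTrueKernel_negLevel_far_eq hβ hΛ he hfar (fun h => hne (by linarith))]
  exact abs_thermalDiagonal_le_of_le hβ hm hme hmu (fun h => hne (by linarith))

/-! ## §3 Two elementary exponential conversions -/

/-- `0 < a`, `0 ≤ y` ⟹ `y³·e^{−a·y} ≤ 6/a³` (`x³/3! ≤ eˣ`). [folklore] -/
theorem pow_three_mul_exp_neg_le {a y : ℝ} (ha : 0 < a) (hy : 0 ≤ y) : y ^ 3 * Real.exp (-(a * y)) ≤ 6 / a ^ 3 := by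
  have h := Real.pow_div_factorial_le_exp (a * y) (by positivity) 3
  have h3 : ((3 : ℕ).factorial : ℝ) = 6 := by norm_num [Nat.factorial]
  rw [h3, div_le_iff₀ (by norm_num : (0 : ℝ) < 6)] at h
  have hexp : Real.exp (-(a * y)) * Real.exp (a * y) = 1 := by rw [← Real.exp_add]; simp
  rw [le_div_iff₀ (by positivity)]
  have hpos := Real.exp_pos (-(a * y))
  nlinarith [mul_le_mul_of_nonneg_left h hpos.le, mul_pow a y 3]

/-! ## §4 Scale bookkeeping on the comparable zone, and the two conversions -/

/-- Near regime conversion: `0 < M ≤ 8q′Λ`, `0 < lo` ⟹ `C₁·M⁻² ≤ 8q′(Λ/lo)C₁·lo·M⁻³`. [folklore] -/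
theorem midNear_conv {C₁ q Λ lo M : ℝ} (hC₁ : 0 ≤ C₁) (hq : 0 < q) (hlo : 0 < lo) (hM : 0 < M) (hMle : M ≤ 8 * q * Λ) :
    C₁ * M⁻¹ ^ 2 ≤ 8 * q * (Λ / lo) * C₁ * lo * M⁻¹ ^ 3 := by
  rw [show 8 * q * (Λ / lo) * C₁ * lo * M⁻¹ ^ 3 = C₁ * ((8 * q * Λ) * M⁻¹) * M⁻¹ ^ 2 by field_simp]
  refine mul_le_mul_of_nonneg_right ?_ (by positivity)
  have : 1 ≤ 8 * q * Λ * M⁻¹ := by rw [le_mul_inv_iff₀ hM]; linarith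
  nlinarith

set_option maxHeartbeats 400000 in
/-- **Far regime on the zone**: `lo ≤ Λ`, `0 < e`, `v ≤ −e/4`, `M = max e |v| > 8q′Λ`, `m̃ᵥ < q′m̃ₑ` (`q′ > 0`) ⟹ with `m := M/(2q′)`:
`m ≤ e`, `m ≤ −v`, `Λ < e`, `Λ < −v`. [folklore] -/
theorem midFar_scales {lo Λ q e v : ℝ} (hlo : 0 < lo) (hloΛ : lo ≤ Λ) (hq : 4 ≤ q) (he : 0 < e) (hv : v ≤ -(e / 4))
    (hfar : 8 * q * Λ < max e |v|) (hz : ppSmoothScale lo v < q * ppSmoothScale lo e) :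
    max e |v| / (2 * q) ≤ e ∧ max e |v| / (2 * q) ≤ -v ∧ Λ < e ∧ Λ < -v := by
  set M : ℝ := max e |v| with hM
  have hq0 : 0 < q := by linarith
  have hΛ0 : 0 < Λ := hlo.trans_le hloΛ
  have hM0 : 0 < M := he.trans_le (le_max_left _ _)
  have hv0 : v < 0 := by linarith
  have hav : |v| = -v := abs_of_neg hv0
  have hlo8 : lo * (8 * q) < M := by nlinarith
  have heq : M / (2 * q) ≤ e := by
    rw [div_le_iff₀ (by positivity)]
    rcases le_total e |v| with h | h
    · have hMv : M = |v| := by rw [hM, max_eq_right h]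
      have hs : ppSmoothScale lo v < q * (e + lo) := hz.trans_le (mul_le_mul_of_nonneg_left
        ((ppSmoothScale_le_add hlo.le e).trans (by rw [abs_of_pos he])) hq0.le)
      have : |v| < q * (e + lo) := (abs_le_ppSmoothScale lo v).trans_lt hs
      nlinarith
    · have hMe : M = e := by rw [hM, max_eq_left h]
      nlinarith
  have hvq : M / (2 * q) ≤ -v := by
    rw [div_le_iff₀ (by positivity), ← hav]
    rcases le_total e |v| with h | h
    · rw [hM, max_eq_right h]; nlinarith [abs_nonneg v]
    · rw [hM, max_eq_left h]; rw [hav]; nlinarith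
  have h4 : 4 * Λ < M / (2 * q) := by rw [lt_div_iff₀ (by positivity)]; nlinarith
  exact ⟨heq, hvq, by linarith, by linarith⟩

set_option maxHeartbeats 400000 in
/-- Conversion `β²·e^{−β(M/(2q′))} ≤ (48q′³/(β·lo))·lo·M⁻³`. [folklore] -/
theorem midFar_conv_sq {β q lo M : ℝ} (hβ : 0 < β) (hq : 0 < q) (hlo : 0 < lo) (hM : 0 < M) :
    β ^ 2 * Real.exp (-(β * (M / (2 * q)))) ≤ 48 * q ^ 3 / (β * lo) * lo * M⁻¹ ^ 3 := by
  have ha : 0 < β / (2 * q) := by positivity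
  have h3 := pow_three_mul_exp_neg_le ha hM.le
  rw [show β / (2 * q) * M = β * (M / (2 * q)) by ring] at h3
  have e1 : 48 * q ^ 3 / (β * lo) * lo * M⁻¹ ^ 3 = β ^ 2 * (6 / (β / (2 * q)) ^ 3) / M ^ 3 := by field_simp; ring
  rw [e1, le_div_iff₀ (by positivity)]
  calc β ^ 2 * Real.exp (-(β * (M / (2 * q)))) * M ^ 3 = β ^ 2 * (M ^ 3 * Real.exp (-(β * (M / (2 * q))))) := by ring
    _ ≤ β ^ 2 * (6 / (β / (2 * q)) ^ 3) := mul_le_mul_of_nonneg_left h3 (by positivity)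

set_option maxHeartbeats 400000 in
/-- Conversion `β·e^{−β(M/(2q′))}·M⁻¹ ≤ (8q′²/(β·lo))·lo·M⁻³`. [folklore] -/
theorem midFar_conv_one {β q lo M : ℝ} (hβ : 0 < β) (hq : 0 < q) (hlo : 0 < lo) (hM : 0 < M) :
    β * Real.exp (-(β * (M / (2 * q)))) * M⁻¹ ≤ 8 * q ^ 2 / (β * lo) * lo * M⁻¹ ^ 3 := by
  have ha : 0 < β / (2 * q) := by positivity
  -- `M²·e^{−aM} ≤ 2/a²` (`x²/2! ≤ eˣ`; inlined — the tree has this fact in an unrelated Literature module)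
  have h2 : M ^ 2 * Real.exp (-(β / (2 * q) * M)) ≤ 2 / (β / (2 * q)) ^ 2 := by
    have h := Real.pow_div_factorial_le_exp (β / (2 * q) * M) (by positivity) 2
    have hf : ((2 : ℕ).factorial : ℝ) = 2 := by norm_num [Nat.factorial]
    rw [hf, div_le_iff₀ (by norm_num : (0 : ℝ) < 2)] at h
    have hexp : Real.exp (-(β / (2 * q) * M)) * Real.exp (β / (2 * q) * M) = 1 := by rw [← Real.exp_add]; simp
    rw [le_div_iff₀ (by positivity)]
    have hpos := Real.exp_pos (-(β / (2 * q) * M))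
    nlinarith [mul_le_mul_of_nonneg_left h hpos.le, mul_pow (β / (2 * q)) M 2]
  rw [show β / (2 * q) * M = β * (M / (2 * q)) by ring] at h2
  have e1 : 8 * q ^ 2 / (β * lo) * lo * M⁻¹ ^ 3 = β * (2 / (β / (2 * q)) ^ 2) / M ^ 3 := by field_simp; ring
  rw [e1, le_div_iff₀ (by positivity)]
  calc β * Real.exp (-(β * (M / (2 * q)))) * M⁻¹ * M ^ 3 = β * (M ^ 2 * Real.exp (-(β * (M / (2 * q))))) := by field_simp
    _ ≤ β * (2 / (β / (2 * q)) ^ 2) := mul_le_mul_of_nonneg_left h2 hβ.le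

/-! ## §5 The row `hKopp` -/

section Row

variable {β Λ : ℝ} (hβ : 0 < β) (hΛ : 0 < Λ) {B₁ B₂ : ℝ} (hB₁ : ∀ x, |deriv salmhoferCutoff x| ≤ B₁) (hB₂ : ∀ x, |deriv (deriv salmhoferCutoff) x| ≤ B₂)
  {κ κ' κ'' : ℝ → ℝ} (hκ : ∀ t, HasDerivAt κ (κ' t) t) (hκ' : ∀ t, HasDerivAt κ' (κ'' t) t) (hκ''c : Continuous κ'')
  {κ₀ κ₁ : ℝ} (hκb : ∀ t ∈ Icc 0 1, |κ t| ≤ κ₀) (hκ'b : ∀ t ∈ Icc 0 1, |κ' t| ≤ κ₁)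
  {t₁ : ℝ} (ht₀ : 0 < t₁) (ht25 : t₁ ≤ 2 / 5)
  (hκs : ∀ t, t₁ ≤ t → κ t = 0) (hκ's : ∀ t, t₁ ≤ t → κ' t = 0) (hκ1 : ∀ t, t ≤ t₁ / 2 → κ t = 1) (hκ'1 : ∀ t, t ≤ t₁ / 2 → κ' t = 0)
  {lo : ℝ} (hlo : 0 < lo) (hloΛ : lo ≤ Λ)

set_option maxHeartbeats 400000 in
include hβ hΛ hB₁ hκb hκ'b hlo in
/-- The zone part of the far regime: `Λ < e`, `Λ < −v`, `v ≠ −e`, `0 ≤ m ≤ e`, `m ≤ −v`, `0 < e` ⟹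
`|∂ᵤP·m_factor + P·(κ′(1−r) − κ′(r))·r′| ≤ (1+2κ₀)β²e^{−βm} + 2κ₁βe^{−βm}(max e |v|)⁻¹`. [cite: BenfattoGiulianiMastropietro2006, §2.4 (2.36)] -/
theorem abs_midDeriv_far_le {e v m : ℝ} (he0 : 0 < e) (he : Λ < e) (hv : Λ < -v) (hne : v ≠ -e) (hm : 0 ≤ m) (hme : m ≤ e) (hmv : m ≤ -v) :
    |ppTrueKernelDu β Λ e v * (1 - κ (ppSmoothRatio lo e v) - κ (1 - ppSmoothRatio lo e v)) +
        ppTrueKernel β Λ e v * ((κ' (1 - ppSmoothRatio lo e v) - κ' (ppSmoothRatio lo e v)) *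
          (-(ppSmoothScale lo e * (v / ppSmoothScale lo v)) / (ppSmoothScale lo e + ppSmoothScale lo v) ^ 2))| ≤
      (1 + 2 * κ₀) * (β ^ 2 * Real.exp (-(β * m))) + 2 * κ₁ * (β * Real.exp (-(β * m)) * (max e |v|)⁻¹) := by
  have hκ₀ : 0 ≤ κ₀ := (abs_nonneg _).trans (hκb 0 (left_mem_Icc.2 zero_le_one))
  have hκ₁ : 0 ≤ κ₁ := (abs_nonneg _).trans (hκ'b 0 (left_mem_Icc.2 zero_le_one))
  have hP' := abs_ppTrueKernelDu_opp_far_le hβ hΛ hB₁ he hv hne hm hme hmv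
  have hP := abs_ppTrueKernel_opp_far_le hβ hΛ he hv hne hm hme hmv
  have hr := ppSmoothRatio_mem_Ioo hlo e v
  have hIcc1 : ppSmoothRatio lo e v ∈ Icc (0 : ℝ) 1 := ⟨hr.1.le, hr.2.le⟩
  have hIcc2 : 1 - ppSmoothRatio lo e v ∈ Icc (0 : ℝ) 1 := ⟨by linarith [hr.2], by linarith [hr.1]⟩
  have hm' : |1 - κ (ppSmoothRatio lo e v) - κ (1 - ppSmoothRatio lo e v)| ≤ 1 + 2 * κ₀ := by
    have hk1 := hκb _ hIcc1; have hk2 := hκb _ hIcc2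
    have h3 := abs_sub (1 : ℝ) (κ (ppSmoothRatio lo e v)); rw [abs_one] at h3
    calc _ ≤ |1 - κ (ppSmoothRatio lo e v)| + |κ (1 - ppSmoothRatio lo e v)| := abs_sub _ _
      _ ≤ 1 + 2 * κ₀ := by linarith
  have hdk : |κ' (1 - ppSmoothRatio lo e v) - κ' (ppSmoothRatio lo e v)| ≤ 2 * κ₁ := by
    have hk1 := hκ'b _ hIcc1; have hk2 := hκ'b _ hIcc2
    calc _ ≤ |κ' (1 - ppSmoothRatio lo e v)| + |κ' (ppSmoothRatio lo e v)| := abs_sub _ _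
      _ ≤ 2 * κ₁ := by linarith
  have hr' : |-(ppSmoothScale lo e * (v / ppSmoothScale lo v)) / (ppSmoothScale lo e + ppSmoothScale lo v) ^ 2| ≤ (max e |v|)⁻¹ := by
    refine (abs_ppSmoothRatioD1_le hlo e v).trans ?_
    have := inv_ppSmoothScale_add_le_inv_max hlo he0.ne' v
    rwa [abs_of_pos he0] at this
  have hA : |ppTrueKernelDu β Λ e v * (1 - κ (ppSmoothRatio lo e v) - κ (1 - ppSmoothRatio lo e v))| ≤ β ^ 2 * Real.exp (-(β * m)) * (1 + 2 * κ₀) := by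
    rw [abs_mul]; exact mul_le_mul hP' hm' (abs_nonneg _) (by positivity)
  have hB : |ppTrueKernel β Λ e v * ((κ' (1 - ppSmoothRatio lo e v) - κ' (ppSmoothRatio lo e v)) *
      (-(ppSmoothScale lo e * (v / ppSmoothScale lo v)) / (ppSmoothScale lo e + ppSmoothScale lo v) ^ 2))| ≤
      β * Real.exp (-(β * m)) * (2 * κ₁ * (max e |v|)⁻¹) := by
    rw [abs_mul, abs_mul]
    exact mul_le_mul hP (mul_le_mul hdk hr' (abs_nonneg _) (by positivity)) (by positivity) (by positivity)
  refine ((abs_add_le _ _).trans (add_le_add hA hB)).trans (le_of_eq ?_)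
  ring

set_option maxHeartbeats 400000 in
include hβ hΛ hB₁ hB₂ hκ hκ' hκ''c hκb hκ'b ht₀ ht25 hκs hκ's hκ1 hκ'1 hlo hloΛ in
/-- **ROW `hKopp` (opposite-sign comparable levels are thermally small)**: `lo ≤ e`, `u ≤ −e/4` ⟹
`|∂ᵤM(e,u)| ≤ (8q′·(Λ/lo)·C₁ + ((1+2κ₀)·48q′³ + 16κ₁q′²)/(β·lo))·lo·(max e |u|)⁻¹³`, `C₁ = (1+2κ₀)C_P1 + 2κ₁(12B₁+9)`, `q′ = (2−t₁)/t₁`.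
[cite: BenfattoGiulianiMastropietro2006, §2.4 (2.36)] -/
theorem abs_deriv_ppMidKernelS_opp_le {e u : ℝ} (he : lo ≤ e) (hu : u ≤ -(e / 4)) :
    |deriv (fun v : ℝ => ppMidKernelS β Λ κ lo e v) u| ≤
      (8 * ((2 - t₁) / t₁) * (Λ / lo) * ((1 + 2 * κ₀) * (128 * B₂ + 216 * B₁ + 294 + (48 * B₁ + 28) * ((2 - t₁) / t₁)) + 2 * κ₁ * (12 * B₁ + 9)) +
          ((1 + 2 * κ₀) * (48 * ((2 - t₁) / t₁) ^ 3) + 16 * κ₁ * ((2 - t₁) / t₁) ^ 2) / (β * lo)) * lo * (max e |u|)⁻¹ ^ 3 := by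
  have hB0 := salmhoferB₁_nonneg hB₁
  have hB20 : 0 ≤ B₂ := (abs_nonneg _).trans (hB₂ 0)
  have hκ₀ : 0 ≤ κ₀ := (abs_nonneg _).trans (hκb 0 (left_mem_Icc.2 zero_le_one))
  have hκ₁ : 0 ≤ κ₁ := (abs_nonneg _).trans (hκ'b 0 (left_mem_Icc.2 zero_le_one))
  have he0 : 0 < e := hlo.trans_le he
  set q : ℝ := (2 - t₁) / t₁ with hq
  have hq4 : 4 ≤ q := midRatio_ge_four ht₀ ht25
  have hq0 : 0 < q := by linarith
  set C₁ : ℝ := (1 + 2 * κ₀) * (128 * B₂ + 216 * B₁ + 294 + (48 * B₁ + 28) * q) + 2 * κ₁ * (12 * B₁ + 9) with hC₁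
  have hC₁0 : 0 ≤ C₁ := by positivity
  set Ct₂ : ℝ := ((1 + 2 * κ₀) * (48 * q ^ 3) + 16 * κ₁ * q ^ 2) / (β * lo) with hCt₂
  have hCt₂0 : 0 ≤ Ct₂ := by positivity
  have hsplit : ∀ M : ℝ, (8 * q * (Λ / lo) * C₁ + Ct₂) * lo * M⁻¹ ^ 3 = 8 * q * (Λ / lo) * C₁ * lo * M⁻¹ ^ 3 + Ct₂ * lo * M⁻¹ ^ 3 := fun M => by ring
  -- the bound off the anti-diagonal point
  have hoff : ∀ v : ℝ, v ≤ -(e / 4) → v ≠ -e → |deriv (fun w : ℝ => ppMidKernelS β Λ κ lo e w) v| ≤ (8 * q * (Λ / lo) * C₁ + Ct₂) * lo * (max e |v|)⁻¹ ^ 3 := by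
    intro v hv hvne
    set M : ℝ := max e |v| with hM
    have hM0 : 0 < M := he0.trans_le (le_max_left _ _)
    have hT1 : 0 ≤ 8 * q * (Λ / lo) * C₁ * lo * M⁻¹ ^ 3 := by positivity
    have hT2 : 0 ≤ Ct₂ * lo * M⁻¹ ^ 3 := by positivity
    rw [hsplit M]
    rcases le_or_gt M (8 * q * Λ) with hnear | hfar
    · have h1 := abs_deriv_ppMidKernelS_le hβ hΛ hB₁ hB₂ hκ hκb hκ'b ht₀ ht25 hκs hκ's hκ1 hκ'1 hlo hloΛ he0 v
      exact (h1.trans (midNear_conv hC₁0 hq0 hlo hM0 hnear)).trans (le_add_of_nonneg_right hT2)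
    · rw [(hasDerivAt_ppMidKernelS_u hβ hΛ hB₁ hκ hlo e v).deriv]
      by_cases hz : ppSmoothScale lo v < (2 - t₁) / t₁ * ppSmoothScale lo e ∧ ppSmoothScale lo e < (2 - t₁) / t₁ * ppSmoothScale lo v
      · obtain ⟨hme, hmv, hefar, hvfar⟩ := midFar_scales hlo hloΛ hq4 he0 hv hfar hz.1
        have h1 := abs_midDeriv_far_le hβ hΛ hB₁ hκb hκ'b hlo he0 hefar hvfar hvne (by positivity) hme hmv
        refine h1.trans ?_
        have hc1 := midFar_conv_sq hβ hq0 hlo hM0 (lo := lo)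
        have hc2 := midFar_conv_one hβ hq0 hlo hM0 (lo := lo)
        have hsum : (1 + 2 * κ₀) * (β ^ 2 * Real.exp (-(β * (M / (2 * q))))) + 2 * κ₁ * (β * Real.exp (-(β * (M / (2 * q)))) * M⁻¹) ≤ Ct₂ * lo * M⁻¹ ^ 3 := by
          have e2 : Ct₂ * lo * M⁻¹ ^ 3 = (1 + 2 * κ₀) * (48 * q ^ 3 / (β * lo) * lo * M⁻¹ ^ 3) + 2 * κ₁ * (8 * q ^ 2 / (β * lo) * lo * M⁻¹ ^ 3) := by
            rw [hCt₂]; field_simp; ring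
          rw [e2]
          exact add_le_add (mul_le_mul_of_nonneg_left hc1 (by positivity)) (mul_le_mul_of_nonneg_left hc2 (by positivity))
        exact hsum.trans (le_add_of_nonneg_left hT1)
      · obtain ⟨h0, h1, h2⟩ := midFactor_eq_zero_of_not_comparable ht₀ ht25 hκs hκ's hκ1 hκ'1 hlo hz
        rw [h0, h1, h2]; simp only [mul_zero, sub_self, zero_mul, add_zero, abs_zero]; positivity
  -- the anti-diagonal point by continuity from the left
  rcases ne_or_eq u (-e) with hne | hueq
  · exact hoff u hu hne
  · have hcont : Continuous (deriv fun w : ℝ => ppMidKernelS β Λ κ lo e w) :=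
      (contDiff_two_ppMidKernelS_u hβ hΛ hB₁ hB₂ hκ hκ' hκ''c hlo e).continuous_deriv (by norm_num)
    have hg : ContinuousAt (fun v : ℝ => (8 * q * (Λ / lo) * C₁ + Ct₂) * lo * (max e |v|)⁻¹ ^ 3) u :=
      continuousAt_const_mul_inv_max_pow he0 ((8 * q * (Λ / lo) * C₁ + Ct₂) * lo) 3 u
    have hev : ∀ᶠ v in 𝓝[<] u, |deriv (fun w : ℝ => ppMidKernelS β Λ κ lo e w) v| ≤ (8 * q * (Λ / lo) * C₁ + Ct₂) * lo * (max e |v|)⁻¹ ^ 3 := by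
      filter_upwards [self_mem_nhdsWithin] with v hv
      have hv' : v < -e := by rw [hueq] at hv; exact hv
      exact hoff v (by linarith) (ne_of_lt hv')
    exact le_of_tendsto_of_tendsto (hcont.abs.continuousAt.tendsto.mono_left nhdsWithin_le_nhds) (hg.tendsto.mono_left nhdsWithin_le_nhds) hev

end Row

end Summit.HubbardSuperconductivity.HubbardSuperconductivity.Theorems.C4a

end
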